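import Literature.MeasureTheory.Group.OrbitalDescentCentralizer     -- ★ p08 (g13): kernel lemmas `continuous_integral_mul_coe_mul_inv`, `integral_comp_coe_mul_left_eq` + the `T = Z(t)` identity
import Literature.MeasureTheory.Group.QuotientOrbitalIntegralProperContinuity   -- ★ p849573: `continuous_descConj_prod` ((HYP) currency)
import Mathlib.Topology.Algebra.ProperAction.Basic                             -- `QuotientGroup.instT2Space` for a closed subgroup
import HarnessLib

/-!
# Harish-Chandra's descent of orbital integrals in CHART-TORUS currency: `∫_{G⧸T} ψ(y t y⁻¹) = ∫_{M⧸T′} ψ_M(k t k⁻¹)` for ANY closed torus `T ≤ M` centralising `t`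
# (Rogawski 1990 §4.12 Lemma 4.12.1, §8.2; Harish-Chandra–van Dijk 1970 Part I §3 Lemmas 22–23; Folland 1995 Thm. 2.49)

Topic `MeasureTheory/Group`; namespace `Literature.MeasureTheory.Group` (continues ★ `OrbitalDescentCentralizer` of F0P3a-p08 (g13)).  THEOREMS ONLY (no definition, no instance,
no notation, no axiom, no named fact, no `sorry`).  GENERIC measure theory on a locally compact second countable group.  Cell `pub/hodgecm-mathlib`, crux H413
(`stmt-HodgeConjecture-24833`), F0∕P3c line LH3 (closer stub `stub_N9`, organ J), brick **(J-DESC) FILE D3** (seat F0P3a-p08 (g22)).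

WHY.  ★ `orbitalIntegral_eq_orbitalIntegral_descended` is written over `Φ^G(t, ψ) = ∫_{G ⧸ Z_G(t)}` and `Φ^M(t, ψ_M) = ∫_{M ⧸ Z_M(t)}` — quotients by the FULL centralisers, which
JUMP at a semi-regular `t = s` (there `Z_G(s) = M`).  The LH3 chart functionals ★ `chartOrbH νH S fH c` ∕ ★ `chartOrbG ν′ S′ a′ c` integrate `descConj (chart c) T_S _ f` over the
FIXED quotient `G ⧸ T_S` by the chart torus `T_S` (★ `chartTorusH`∕`chartTorusG`, `= Z(t)` only at regular `t`, ★ `chartTorusG_eq_centralizer`), at EVERY `c`, walls included.  The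
descent the J-organ needs near a wall is therefore the SAME identity with an ARBITRARY closed subgroup `T` centralising `t` in place of `Z_G(t)` (and `T′ ≤ M`, `T′ ↪ T`
measure-matched, in place of `Z_M(t)`):
  **`∫_{G⧸T} ψ(y t y⁻¹) d(ν∕νT) = ∫_{M⧸T′} ψ_M(k t k⁻¹) d(νM∕νT′)`**,  `ψ_M(m) = ∫_G β(x) • ψ(x m x⁻¹) dν`,
under the «compact modulo `M`» hypothesis at `t` and — replacing the closedness of the class of `t`, which is what made the `Z_G(t)`-integrand integrable — the INTEGRABILITY of the
`G`-side integrand on `G ⧸ T` (automatic from uniform properness modulo `T` at `t`, §1, i.e. at regular chart points: ★ (W1-cont)).  The proof is ★'s, token for token, with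
`Z_G(t) ↦ T`, `Z_M(t) ↦ T′` (the kernel lemmas of ★ `OrbitalDescentCentralizer` §Kernel and the Weil∕Fubini steps ★ `OrbitalDescentWeilStep`∕`OrbitalDescentFubini` were already
written for an arbitrary `T`).  NO constant survives.
* §1 `integrable_descConj_of_exists_isCompact` — (HYP)-properness at ONE point ⇒ the orbital integrand on `G ⧸ T` is continuous with compact support, hence integrable for
  every measure finite on compacts.
* §2 **`integral_descConj_eq_integral_descConj_descended`** — the identity above.
With ★∕filed D1b `UnitaryGroup.exists_isCompact_mul_diagonal_of_ne` (ONE `C` for all `t` near the Cayley wall of `U(2,1)`, `M = Z(s) ⊇ U(1,1)`) and ★∕filed D2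
`exists_continuous_hasCompactSupport_integral_comp_mul_eq_one` ∕ `continuous_integral_conj` (ONE cut-off `β`, `ψ_M ∈ C_c(M)`), this gives: for all regular `c` near the wall,
`chartOrbG ν′ S′ a′ c = dt′(B′) · ∫_{M ⧸ T′} (a′)_M(k · gprimeTorus c · k⁻¹)` with ONE `(a′)_M` — the `G′`-jump at the wall is an `M`-jump (★ (K0±)-U11).
HONEST LABEL: HC_CM is proved only modulo the 7 printed citations (2 remaining named inputs: hLiu418 = `stmt-HodgeConjecture-24832`, h413 = `stmt-HodgeConjecture-24833`) until rung 0
closes; generic measure theory, count-neutral.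

## References
* [Rogawski1990] J. D. Rogawski, *Automorphic Representations of Unitary Groups in Three Variables*, Ann. of Math. Stud. 123 (1990), §4.12 Lemma 4.12.1 p. 66 (the three-line
  computation `Φ_ε(xδ₀, ϕ) = ∫_{Z̃M∖G̃} ∫_{M_x∖M} ᾱ(g) ϕ(…) = Φ_M(x, φ)`), §8.2 p. 114.
* [HarishChandra1970] Harish-Chandra (notes by G. van Dijk), *Harmonic Analysis on Reductive p-adic Groups*, LNM 162 (1970), Part I §3 Lemmas 22–23.
* [Folland1995] G. B. Folland, *A Course in Abstract Harmonic Analysis* (1995), §2.6 Thm. 2.49 (Weil's formula).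
* [DeitmarEchterhoff2014] A. Deitmar, S. Echterhoff, *Principles of Harmonic Analysis*, 2nd ed. (2014), Lemma 9.3.3, Thm. 1.5.3.
-/

set_option autoImplicit false

noncomputable section

open MeasureTheory MeasureTheory.Measure Topology Set Filter Function
open scoped Pointwise

namespace Literature.MeasureTheory.Group

/-! ## §1 Properness at one point ⇒ integrability of the orbital integrand on `G ⧸ T` -/

section Integrable

variable {G : Type*} [Group G] [TopologicalSpace G] [IsTopologicalGroup G]

/-- **(HYP) at one point ⇒ the orbital integrand is `C_c` on `G ⧸ T`, hence integrable** for every measure finite on compact sets: if one compact `𝒦 ⊆ G ⧸ T` contains `yT`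
whenever `y t y⁻¹ ∈ tsupport ψ` (★ (W1-cont) at a regular chart point), then `ȳ ↦ ψ(y t y⁻¹)` is continuous (★ `continuous_descConj_prod`) and supported in `𝒦`.
[cite: DeitmarEchterhoff2014, Lemma 9.3.3] [cite: Rogawski1990, §8.3 p. 122] -/
theorem integrable_descConj_of_exists_isCompact (T : Subgroup G) (hT : IsClosed (T : Set G)) (t : G) (htT : ∀ s ∈ T, s * t = t * s)
    {E : Type*} [NormedAddCommGroup E] [NormedSpace ℝ E] {ψ : G → E} (hψc : Continuous ψ)
    {𝒦 : Set (G ⧸ T)} (h𝒦 : IsCompact 𝒦) (hmem : ∀ y : G, y * t * y⁻¹ ∈ tsupport ψ → (QuotientGroup.mk y : G ⧸ T) ∈ 𝒦)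
    [MeasurableSpace (G ⧸ T)] [OpensMeasurableSpace (G ⧸ T)] (μ : Measure (G ⧸ T)) [IsFiniteMeasureOnCompacts μ] :
    Integrable (descConj t T htT ψ) μ := by
  have hc : Continuous (descConj t T htT ψ) := by
    have h := continuous_descConj_prod (X := Unit) T (c := fun _ => t) continuous_const (fun _ => htT) hψc
    exact h.comp (Continuous.prodMk_right ())
  haveI : IsClosed (T : Set G) := hT
  have hs : HasCompactSupport (descConj t T htT ψ) := by
    refine HasCompactSupport.of_support_subset_isCompact h𝒦 fun q hq => ?_
    induction q using QuotientGroup.induction_on with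
    | H y =>
      rw [Function.mem_support, descConj_mk] at hq
      exact hmem y (subset_tsupport _ hq)
  exact hc.integrable_of_hasCompactSupport hs

end Integrable

/-! ## §2 The descent identity for an arbitrary closed torus `T ≤ M` centralising `t` -/

section Descent

variable {G : Type*} [Group G] [TopologicalSpace G] [IsTopologicalGroup G] [LocallyCompactSpace G] [SecondCountableTopology G]
  [T2Space G] [MeasurableSpace G] [BorelSpace G]

/-- **HARISH-CHANDRA'S DESCENT IN CHART-TORUS CURRENCY** (module docstring): for `t ∈ M ≤ G` (`M` closed), a closed subgroup `T ≤ G` centralising `t` and a closed subgroup `T′ ≤ M`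
centralising `t` with `T′ ↪ T` and matched Haar measures `νT = incl_* νT′`, canonical quotient measures `ν∕νT` on `G ⧸ T` and `νM∕νT′` on `M ⧸ T′`, a cut-off `β ∈ C_c(G)`,
`β ≥ 0`, of unit `M`-mass on `C·M`, a test function `ψ ∈ C_c(G)` that is «compact modulo `M` at `t`» (`y t y⁻¹ ∈ tsupport ψ ⇒ y ∈ C·M`) and whose orbital integrand is integrable on
`G ⧸ T`:  `∫_{G⧸T} ψ(y t y⁻¹) d(ν∕νT)(ẏ) = ∫_{M⧸T′} ψ_M(k t k⁻¹) d(νM∕νT′)(k̇)`, `ψ_M(m) = ∫_G β(x) • ψ(x m x⁻¹) dν`.  (At `T = Z_G(t)`, `T′ = Z_M(t)` this is ★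
`orbitalIntegral_eq_orbitalIntegral_descended`; the proof is the same kernel∕Weil∕Fubini argument, no constant survives.)
[cite: Rogawski1990, §4.12 Lemma 4.12.1 p. 66; §8.2 p. 114] [cite: HarishChandra1970, Part I §3 Lemmas 22–23] [cite: Folland1995, §2.6 Thm. 2.49] -/
theorem integral_descConj_eq_integral_descConj_descended
    (ν : Measure G) [ν.IsHaarMeasure] [ν.IsMulRightInvariant]
    (M : Subgroup G) (hM : IsClosed (M : Set G))
    (νM : Measure M) [νM.IsHaarMeasure] [νM.IsMulRightInvariant] [νM.IsInvInvariant]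
    (t : M)
    (T : Subgroup G) (hT : IsClosed (T : Set G)) (htT : ∀ s ∈ T, s * (t : G) = (t : G) * s)
    (T' : Subgroup M) (hT' : IsClosed (T' : Set M)) (htT' : ∀ s ∈ T', s * t = t * s)
    (hTT' : ∀ s : M, s ∈ T' → (s : G) ∈ T)
    [MeasurableSpace (G ⧸ T)] [BorelSpace (G ⧸ T)]
    [MeasurableSpace (M ⧸ T')] [BorelSpace (M ⧸ T')]
    (νT : Measure T) [νT.IsHaarMeasure] [νT.IsMulRightInvariant] [νT.IsInvInvariant]
    (νT' : Measure T') [νT'.IsHaarMeasure] [νT'.IsInvInvariant]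
    (hνT : νT = Measure.map (fun s : T' => (⟨((s : M) : G), hTT' (s : M) s.2⟩ : T)) νT')
    {C : Set G} {β : G → ℝ} (hβc : Continuous β) (hβs : HasCompactSupport β) (hβ0 : ∀ g, 0 ≤ β g)
    (hβ1 : ∀ c ∈ C, ∀ k₀ : M, ∫ h : M, β (c * (k₀ : G) * (h : G)) ∂νM = 1)
    {ψ : G → ℂ} (hψc : Continuous ψ)
    (hint : Integrable (descConj (t : G) T htT ψ) (quotientMeasure T νT hT ν))
    (hCM : ∀ y : G, y * (t : G) * y⁻¹ ∈ tsupport ψ → y ∈ C * (M : Set G)) :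
    ∫ yq, descConj (t : G) T htT ψ yq ∂(quotientMeasure T νT hT ν) =
      ∫ kq, descConj t T' htT' (fun m : M => ∫ x, β x • ψ (x * (m : G) * x⁻¹) ∂ν) kq ∂(quotientMeasure T' νT' hT' νM) := by
  -- adapted from ★ `Literature/MeasureTheory/Group/OrbitalDescentCentralizer.lean` (F0P3a-p08 (g13)): `Z_G(t) ↦ T`, `Z_M(t) ↦ T′`
  classical
  -- the integrand on the `G`-side
  set F : G ⧸ T → ℂ := descConj (t : G) T htT ψ with hFdef
  have hFint : Integrable F (quotientMeasure T νT hT ν) := hint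
  /- (1) the kernel: `A2 (y, k) = ∫_T β(y s k⁻¹) dνT`, its descended version `A` and its properties -/
  set A2 : G × G → ℝ := fun p => ∫ s : T, β (p.1 * (s : G) * p.2⁻¹) ∂νT with hA2
  have hA2c : Continuous A2 := continuous_integral_mul_coe_mul_inv T νT hT hβc hβs
  -- invariances: left `T` in `y`, right `T′` in `k`
  have hA2y : ∀ (y k : G) (s₀ : T), A2 (y * (s₀ : G), k) = A2 (y, k) := fun y k s₀ => by
    simp only [hA2]
    exact integral_comp_coe_mul_left_eq T νT β y k s₀
  have hA2k : ∀ (y : G) (k : M) (s₀ : T'), A2 (y, ((k * (s₀ : M) : M) : G)) = A2 (y, (k : G)) := fun y k s₀ => by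
    simp only [hA2, Subgroup.coe_mul]
    have hs₀ : ((s₀ : M) : G) ∈ T := hTT' (s₀ : M) s₀.2
    exact integral_comp_mul_coe_mul_inv_eq T νT β y (k : G) ⟨_, hs₀⟩
  -- the descended kernel
  set A : G ⧸ T → M ⧸ T' → ℝ := fun yq kq => A2 (Quotient.out yq, ((Quotient.out kq : M) : G)) with hAdef
  have hAmk : ∀ (y : G) (k : M), A (QuotientGroup.mk y) (QuotientGroup.mk k) = A2 (y, (k : G)) := by
    intro y k
    simp only [hAdef]
    -- representatives: `out (mk y) = y s₀`, `out (mk k) = k s₁`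
    have hy : ∃ s₀ : T, (Quotient.out (QuotientGroup.mk y : G ⧸ T) : G) = y * (s₀ : G) := by
      have h := QuotientGroup.mk_out_eq_mul T y
      exact ⟨_, h.choose_spec⟩
    have hk : ∃ s₁ : T', (Quotient.out (QuotientGroup.mk k : M ⧸ T') : M) = k * (s₁ : M) := by
      have h := QuotientGroup.mk_out_eq_mul T' k
      exact ⟨_, h.choose_spec⟩
    obtain ⟨s₀, hs₀⟩ := hy
    obtain ⟨s₁, hs₁⟩ := hk
    rw [hs₀, hs₁, hA2y, hA2k]
  have hAcont : Continuous (uncurry A) := by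
    have hq : IsOpenQuotientMap (Prod.map (QuotientGroup.mk : G → G ⧸ T) (QuotientGroup.mk : M → M ⧸ T')) :=
      (QuotientGroup.isOpenQuotientMap_mk (N := T)).prodMap (QuotientGroup.isOpenQuotientMap_mk (N := T'))
    rw [← hq.continuous_comp_iff]
    have heq : uncurry A ∘ Prod.map (QuotientGroup.mk : G → G ⧸ T) (QuotientGroup.mk : M → M ⧸ T') =
        fun p : G × M => A2 (p.1, (p.2 : G)) := by
      funext p; exact hAmk p.1 p.2
    rw [heq]
    exact hA2c.comp (continuous_fst.prodMk (continuous_subtype_val.comp continuous_snd))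
  have hAmeas : Measurable (uncurry A) := hAcont.measurable
  have hA0 : ∀ yq kq, 0 ≤ A yq kq := fun yq kq => integral_nonneg fun s => hβ0 _
  /- (2) unit mass: `∫_{M⧸T′} A(ẏ, ·) = 1` whenever `F ẏ ≠ 0` -/
  have hA1 : ∀ yq : G ⧸ T, F yq ≠ 0 → ∫ kq, A yq kq ∂(quotientMeasure T' νT' hT' νM) = 1 := by
    intro yq hyq
    obtain ⟨y, rfl⟩ := QuotientGroup.mk_surjective yq
    -- `y ∈ C·M`
    have hy : y ∈ C * (M : Set G) := by
      apply hCM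
      have h : ψ (y * (t : G) * y⁻¹) ≠ 0 := by rwa [hFdef, descConj_mk] at hyq
      exact subset_tsupport _ h
    obtain ⟨c, hc, k₀, hk₀, rfl⟩ := hy
    -- the function `f(m) = β(y m⁻¹)` on `M`, compactly supported and continuous
    have hfc : Continuous fun m : M => β (c * k₀ * (m : G)⁻¹) := hβc.comp (continuous_const.mul continuous_subtype_val.inv)
    have hfs : HasCompactSupport fun m : M => β (c * k₀ * (m : G)⁻¹) := by
      have hKc : IsCompact (((c * k₀)⁻¹ • tsupport β)⁻¹ : Set G) := (hβs.isCompact.smul (c * k₀)⁻¹).inv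
      refine HasCompactSupport.intro' ((hM.isClosedEmbedding_subtypeVal).isCompact_preimage hKc)
        (((hM.isClosedEmbedding_subtypeVal).isCompact_preimage hKc).isClosed) fun m hm => ?_
      by_contra hne
      apply hm
      change (m : G) ∈ ((c * k₀)⁻¹ • tsupport β)⁻¹
      rw [Set.mem_inv, Set.mem_smul_set_iff_inv_smul_mem, inv_inv, smul_eq_mul]
      exact subset_tsupport _ hne
    set f : CompactlySupportedContinuousMap M ℝ := ⟨⟨fun m : M => β (c * k₀ * (m : G)⁻¹), hfc⟩, hfs⟩ with hfdef
    -- `A (mk y) (mk k) = fiberIntegral T′ νT′ f (mk k)`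
    have hAf : ∀ k : M, A (QuotientGroup.mk (c * k₀)) (QuotientGroup.mk k) = fiberIntegral T' νT' f (QuotientGroup.mk k) := by
      intro k
      rw [hAmk, fiberIntegral_mk]
      simp only [hA2]
      -- transport `νT = incl_* νT′`
      have hcont : Continuous fun s : T => β (c * k₀ * (s : G) * (k : G)⁻¹) :=
        hβc.comp ((continuous_const.mul continuous_subtype_val).mul continuous_const)
      have hφ : Continuous fun s : T' => (⟨((s : M) : G), hTT' (s : M) s.2⟩ : T) :=
        Continuous.subtype_mk (continuous_subtype_val.comp continuous_subtype_val) _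
      rw [hνT, integral_map hφ.aemeasurable hcont.aestronglyMeasurable]
      -- inversion invariance of `νT′` on the right-hand side
      have hinv : ∫ h : T', (f : M → ℝ) (k * (h : M)) ∂νT' = ∫ h : T', (f : M → ℝ) (k * ((h⁻¹ : T') : M)) ∂νT' :=
        (integral_inv_eq_self (fun h : T' => (f : M → ℝ) (k * (h : M))) νT').symm
      rw [hinv]
      refine integral_congr_ae (Eventually.of_forall fun s => ?_)
      simp only [hfdef, CompactlySupportedContinuousMap.coe_mk, ContinuousMap.coe_mk, Subgroup.coe_mul, Subgroup.coe_inv, mul_inv_rev,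
        inv_inv, mul_assoc]
    have hcongr : (fun kq => A (QuotientGroup.mk (c * k₀)) kq) = fun kq => fiberIntegral T' νT' f kq := by
      funext kq
      obtain ⟨k, rfl⟩ := QuotientGroup.mk_surjective kq
      exact hAf k
    rw [hcongr, integral_fiberIntegral_quotientMeasure]
    -- `∫_M β(c k₀ m⁻¹) dνM = ∫_M β(c k₀ m) dνM = 1`
    change ∫ m : M, β (c * k₀ * (m : G)⁻¹) ∂νM = 1
    have hinvM : ∫ m : M, β (c * k₀ * (m : G)⁻¹) ∂νM = ∫ m : M, β (c * k₀ * (m : G)) ∂νM := by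
      have h := integral_inv_eq_self (fun m : M => β (c * k₀ * (m : G))) νM
      simp only [Subgroup.coe_inv] at h
      exact h
    rw [hinvM]
    exact hβ1 c hc ⟨k₀, hk₀⟩
  /- (3) the `M`-side integrand equals `∫_{G⧸T} F · A(·, k̇)` -/
  have hMside : ∀ k : M,
      descConj t T' htT' (fun m : M => ∫ x, β x • ψ (x * (m : G) * x⁻¹) ∂ν) (QuotientGroup.mk k) =
        ∫ yq, F yq * (A yq (QuotientGroup.mk k) : ℂ) ∂(quotientMeasure T νT hT ν) := by
    intro k
    rw [descConj_mk]
    change ∫ x, β x • ψ (x * (((k * t * k⁻¹ : M)) : G) * x⁻¹) ∂ν = _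
    have hcoe : (((k * t * k⁻¹ : M)) : G) = (k : G) * (t : G) * (k : G)⁻¹ := by simp
    rw [hcoe, integral_smul_conj_conj_eq_integral_mul_right ν β ψ (t : G) (k : G)]
    -- real `•` on `ℂ` is multiplication by the real cast
    have hsm : (fun x => β (x * (k : G)⁻¹) • ψ (x * (t : G) * x⁻¹)) = fun x => (β (x * (k : G)⁻¹) : ℂ) * ψ (x * (t : G) * x⁻¹) := by
      funext x; rw [Complex.real_smul]
    rw [hsm]
    -- Weil on `G ⊇ T` with constant `1`
    have hW := mul_integral_mul_descConj_eq_integral_fiberIntegralE_mul T νT (quotientMeasure T νT hT ν) ν (t : G) htT hβc hβs hψc (k : G)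
    rw [unfoldingConstant_quotientMeasure, NNReal.coe_one] at hW
    have hW' : ∫ x, (β (x * (k : G)⁻¹) : ℂ) * ψ (x * (t : G) * x⁻¹) ∂ν =
        ∫ y, fiberIntegralE T νT (fun x => (β (x * (k : G)⁻¹) : ℂ)) y * descConj (t : G) T htT ψ y ∂(quotientMeasure T νT hT ν) := by
      rw [← hW]; push_cast; ring
    rw [hW']
    refine integral_congr_ae (Eventually.of_forall fun yq => ?_)
    obtain ⟨y, rfl⟩ := QuotientGroup.mk_surjective yq
    dsimp only
    rw [fiberIntegralE_mk, hAmk, integral_complex_ofReal, mul_comm]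
  /- (4) assembly: Fubini with the unit-mass kernel -/
  change ∫ yq, F yq ∂(quotientMeasure T νT hT ν) = ∫ kq, descConj t T' htT' (fun m : M => ∫ x, β x • ψ (x * (m : G) * x⁻¹) ∂ν) kq ∂(quotientMeasure T' νT' hT' νM)
  have hcongr : (fun kq => descConj t T' htT' (fun m : M => ∫ x, β x • ψ (x * (m : G) * x⁻¹) ∂ν) kq) =
      fun kq => ∫ yq, F yq * (A yq kq : ℂ) ∂(quotientMeasure T νT hT ν) := by
    funext kq
    obtain ⟨k, rfl⟩ := QuotientGroup.mk_surjective kq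
    exact hMside k
  rw [hcongr, integral_integral_mul_kernel_eq_integral (quotientMeasure T νT hT ν) (quotientMeasure T' νT' hT' νM) hFint hAmeas hA0 hA1]


end Descent

end Literature.MeasureTheory.Group
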